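import Summits.Ventures.HodgeRepro2.T6A2WeilKappa

/-!
# T6A2WeilShadow — THE TRANSFER SHADOW OF THE CORNER PRODUCT ON THE HOST WEIL COHOMOLOGY

Cell pub-hodge-repro2, Tier 6 (README §10), seat t6-p2 (A2 host side; lead ruling STATUS l. 5353 (4)). The
assembly: from the host Weil cohomology `W : WeilCohomology k ℚ` (`k` in `Type`, the cell's `k = ℂ`), the A2
situation `D : SituationData k` (`B` with its addition `m`, the surface `f : S → B`), its generic points
`hgen` and product smoothness `hten` (the host's named Prop `IsSmoothProjective.tensor`), the dimensions
`dim B = 12`, `dim S = 2`, the group law `G` (unit + unit laws), `hpt : IsSmoothProjective 0 pt` (the host's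
named Prop `isSmoothProjective_unit`), the A1-side datum `A : OrderAction W D.B K` (the order acting by
endomorphisms and the rational `K`-equivariant `φ₁`, owner t6-p1), the Lange display binder `hL` and the
Lefschetz (1,1) binder `hLef` (T6A2Hyp / T6A2LefProofs), this file builds
* `alg_pont_even_weil` — the even Pontryagin identity of the lead's `ShadowData` (`p = ev (a ⋆ b)`; the
  identity `∫_B (a ⋆ b) ∪ u = ∫_{B×B} (a ⊗ b) ∪ m^* u` is `push_pull_mul` + `integral_push` on the host,
  transported by `κ`, `κ_cop`, `intBBOf_eq_integralF_κ`);
* **`shadowDataWeil : OfData.ShadowData F`** — every field of the lead's `ShadowData` from the files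
  T6A2WeilIdent / Grading / Psi / Surface / Coproduct / Kappa (only `alg_lefschetz` is a binder);
* **`transferShadowWeil : TransferShadow F`** := `TransferShadow.ofData shadowDataWeil` — THE INSTANTIATED
  `D` of Theorem A on the host (the lead's M1 `theoremA_of_N` applies to it).
No display is consumed in this file; the printed inputs are the displays of T6A2Hyp (Lefschetz (1,1), through
`hLef`) and the owner's Lange display (through `hL`). No `sorry`; standard axioms.
§8(d): uses an L-value-free non-vanishing device: NO.
-/

noncomputable section

namespace Summit.Ventures.HodgeRepro2.T6.WeilInst

open HostAPI.Carriers.AlgebraicGeometry.Motives CategoryTheory Opposite MonoidalCategory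
  CartesianMonoidalCategory
open Summit.Ventures.HodgeRepro2.T6 Summit.Ventures.HodgeRepro2.T6.A2Gysin
  Summit.Ventures.HodgeRepro2.T6.A2Shadow
open scoped DirectSum TensorProduct

variable {k : Type} [Field k] (W : WeilCohomology k ℚ)
variable {K : Type*} [Field K] [NumberField K] (D : SituationData k) (hgen : D.HasGens) (hten : D.ProductsSmooth)
  (A : OrderAction W D.B K) (hL : Function.Bijective (langeMap W D.B))

/-- even-ring images commute in the full ring -/
theorem evenToFull_mul_comm (P : SPVar k) (x y : EvenRing W P) :
    evenToFull W P x * evenToFull W P y = evenToFull W P y * evenToFull W P x := by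
  rw [← map_mul, ← map_mul, mul_comm]

/-- `∫_B` kills every degree `≠ 24` (`dim B = 12`) -/
theorem intBW_deg (hdim : D.B.n = 12) : ∀ k' ≠ 24, ∀ a ∈ degB K k', intBW W D A hL a = 0 := by
  intro k' hk a ha
  obtain ⟨j, hj | hj⟩ := Nat.even_or_odd' k'
  · subst hj
    exact integral_psiOf_of_ne W D A hL hdim j (by omega) a ha
  · subst hj
    show integral W D.B (psiOf W D A hL a) = 0
    rw [psiOf_odd W D A hL j a ha, map_zero]

/-- THE EVEN PONTRYAGIN IDENTITY ON THE HOST (the lead's `ShadowData.alg_pont_even`): for algebraic `a`, `b`,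
`p := ev (a ⋆ b)` is algebraic of degree `2(k + l − 12)` and `∫_B p ∪ u = ∫_{B×B} (a ⊗ b) ∪ m^* u` for every
even `u`, with the lead's `∫_{B×B} = ∫_B ⊗ ∫_B` and shuffle coproduct `Toy.cop`. -/
theorem alg_pont_even_weil (hdim : D.B.n = 12) (G : GroupLaw D) (hpt : IsSmoothProjective 0 (𝟙_ (SchemeOver k)))
    {k' l : ℕ} {a b : HB K} (ha : a ∈ (identB W D hgen hten A hL).algOf k')
    (hb : b ∈ (identB W D hgen hten A hL).algOf l) :
    ∃ p ∈ (identB W D hgen hten A hL).algOf (k' + l - 12), ∀ (j : ℕ) (u : HB K), u ∈ degB K (2 * j) →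
      intBW W D A hL (p * u) = OfData.intBBOf K (intBW W D A hL) (inl K a * inr K b * Toy.cop K u) := by
  have hPD := D.poincareDuality W hgen hten
  have hF1 := (D.cycleTheory_hypotheses W hgen hten).2.2.2.2.2.1
  have hR := (D.cycleTheory_hypotheses W hgen hten).2.2.2.2.2.2
  obtain ⟨a', ha', rfl⟩ := IdentBB.exists_mem_Alg_of_mem_span (I := identB W D hgen hten A hL) ha.1
  obtain ⟨b', hb', rfl⟩ := IdentBB.exists_mem_Alg_of_mem_span (I := identB W D hgen hten A hL) hb.1
  refine ⟨(identB W D hgen hten A hL).ev ((D.situation W hgen hten).pont hPD a' b'),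
    ⟨Submodule.subset_span ⟨_, (D.situation W hgen hten).pont_mem_Alg hPD hF1 hR ha' hb', rfl⟩,
      pont_deg_weil W D hgen hten A hL hdim hPD k' l a' b' ha.2 hb.2⟩, ?_⟩
  intro j u hu
  rw [identB_ev] at *
  -- the left side: `∫_B (a' ⋆ b') ∪ ψ u = ∫_{B×B} m^* ψu ∪ (pr₁^* a' ∪ pr₂^* b')`
  have hL1 : intBW W D A hL (evOf W D A hL ((D.situation W hgen hten).pont hPD a' b') * u) =
      integralF W D.BB (evenToFull W D.BB
        (pull W (P := D.BB) (Q := D.B) D.m (psiOf W D A hL u) *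
          (pull W (P := D.BB) (Q := D.B) (fst D.B.X D.B.X) a' *
            pull W (P := D.BB) (Q := D.B) (snd D.B.X D.B.X) b'))) := by
    show integral W D.B (psiOf W D A hL (evOf W D A hL _ * u)) = _
    rw [psiOf_evOf_mul_even W D A hL _ j u hu, pont_eq_push, mul_comm, ← mul_one (psiOf W D A hL u),
      ← push_pull_mul, mul_one, integral_push, integralF_evenToFull]
  -- the right side: `∫_{B×B} (κ (inl a * inr b * cop u))`
  have hR1 : OfData.intBBOf K (intBW W D A hL)
      (inl K (evOf W D A hL a') * inr K (evOf W D A hL b') * Toy.cop K u) =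
      integralF W D.BB (evenToFull W D.BB
        (pull W (P := D.BB) (Q := D.B) (fst D.B.X D.B.X) a' *
          pull W (P := D.BB) (Q := D.B) (snd D.B.X D.B.X) b' *
            pull W (P := D.BB) (Q := D.B) D.m (psiOf W D A hL u))) := by
    rw [intBBOf_eq_integralF_κ, map_mul (κ W D A hL), map_mul (κ W D A hL), κ_inl, κ_inr,
      κ_cop W D A hL G hpt, legL_apply, legR_apply, evOf_eq_evF, evOf_eq_evF, AlgEquiv.symm_apply_apply,
      AlgEquiv.symm_apply_apply, map_mul (evenToFull W D.BB), map_mul (evenToFull W D.BB), evenToFull_pull,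
      evenToFull_pull, evenToFull_pull, psiOf_apply,
      evenToFull_fullToEven_of_mem W D.B (evF_symm_mem_range_ofDegF W D A hL hu)]
  refine hL1.trans (Eq.trans ?_ hR1.symm)
  congr 2
  exact mul_comm _ _

/-- the surface shadow is in `Type` (the cell's `k = ℂ` lives in `Type`) -/
example : Type := HSW W D

/-- **THE SHADOW DATA OF THE CORNER PRODUCT ON THE HOST WEIL COHOMOLOGY** — every field of the lead's
`OfData.ShadowData F` (T6InterfaceOfData) from the A2 host files; `alg_lefschetz` is the Lefschetz (1,1)
binder `hLef` (discharged from the Voisin displays of T6A2Hyp by T6A2LefProofs modulo the divisor-class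
datum), everything else is a theorem of the host axiomatics. -/
def shadowDataWeil (F : FaceSetting K) (hdim : D.B.n = 12) (hdimS : D.S.n = 2) (G : GroupLaw D)
    (hpt : IsSmoothProjective 0 (𝟙_ (SchemeOver k)))
    (hLef : ∀ a ∈ degB K 2, extC K a ∈ hodge F 1 1 → a ∈ (identB W D hgen hten A hL).algOf 1) :
    OfData.ShadowData F where
  Alg := (identB W D hgen hten A hL).algOf
  alg_deg := (identB W D hgen hten A hL).algOf_le_degB
  alg_one := (identB W D hgen hten A hL).one_mem_algOf (D.cycleTheory_hypotheses W hgen hten).2.2.2.2.2.2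
  alg_mul := (identB W D hgen hten A hL).mul_mem_algOf (D.cycleTheory_hypotheses W hgen hten).2.2.2.2.2.2
  alg_pull := (identB W D hgen hten A hL).pullEndo_mem_algOf (D.cycleTheory_hypotheses W hgen hten).2.2.2.2.2.2
  alg_lefschetz := hLef
  intB := intBW W D A hL
  intB_deg := intBW_deg W D A hL hdim
  intB_ne_zero := exists_integral_psiOf_ne_zero W D A hL F hdim
  alg_pont_even := alg_pont_even_weil W D hgen hten A hL hdim G hpt
  HS := HSW W D
  pull := pullS W D A
  intS := intSW W D
  z := zW W D hgen hten A hL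
  z_deg := zW_deg W D hgen hten A hL hdim hdimS
  z_alg := zW_mem_algOf W D hgen hten A hL hdim hdimS
  z_proj := zW_proj W D hgen hten A hL hdim hdimS

/-- **THE TRANSFER SHADOW OF THE CORNER PRODUCT ON THE HOST**: the lead's `TransferShadow.ofData` of
`shadowDataWeil` — the instantiated `D` of Theorem A (`theoremA_of_N`). -/
def transferShadowWeil (F : FaceSetting K) (hdim : D.B.n = 12) (hdimS : D.S.n = 2) (G : GroupLaw D)
    (hpt : IsSmoothProjective 0 (𝟙_ (SchemeOver k)))
    (hLef : ∀ a ∈ degB K 2, extC K a ∈ hodge F 1 1 → a ∈ (identB W D hgen hten A hL).algOf 1) :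
    TransferShadow F :=
  TransferShadow.ofData (shadowDataWeil W D hgen hten A hL F hdim hdimS G hpt hLef)

/-- the algebraic classes of the host transfer shadow are the spans of the host's algebraic classes -/
theorem transferShadowWeil_Alg (F : FaceSetting K) (hdim : D.B.n = 12) (hdimS : D.S.n = 2) (G : GroupLaw D)
    (hpt : IsSmoothProjective 0 (𝟙_ (SchemeOver k)))
    (hLef : ∀ a ∈ degB K 2, extC K a ∈ hodge F 1 1 → a ∈ (identB W D hgen hten A hL).algOf 1) :
    (transferShadowWeil W D hgen hten A hL F hdim hdimS G hpt hLef).Alg = (identB W D hgen hten A hL).algOf := rfl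

end Summit.Ventures.HodgeRepro2.T6.WeilInst

end
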